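import Summits.AnomalousDissipation.AnomalousDissipation.Theorems.RestMeanFloorTG.Negative.ShearSpinUp
import Literature.Analysis.FluidPDE.TorusWeakStrongUniquenessForced
import Literature.Analysis.FluidPDE.LerayHopfGalileanTorusMeans

/-!
# Every laminar line of every Kolmogorov shear force is rigid (negative lane of `RestMeanFloorTG`, 24255)

Negative-lane proof file (theorems only; no `sorry`; no Theses statement asserted positively).
`ShearFromRestUnique` settled the from-rest case of the unit shear force `shear 0 1`; here the same
mechanism (forced weak–strong uniqueness on `T³` against an explicit classical laminar solution) is run
for the whole family `shear n b = (0, 0, b cos 2π(n+1)x₀)` and every datum `shear n a₀` on its laminar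
line. With `c = 4π²(n+1)²ν`, `A = b/c`, the laminar flow is `shear n (A + (a₀ − A)e^{−ct})` and:
`isClassicalNSSolutionOn_ampShearMode` (modulated mode-`n` shears are classical solutions, force
`shear n (a' + c a)`); `ae_eq_laminar_of_isGlobalLerayHopf_shearMode` (every global Leray–Hopf solution
with force `shear n b`, datum `shear n a₀` is laminar a.e. at every `t > 0`);
`le_meanEnergy_of_isGlobalLerayHopf_shearMode` (`⟨‖u‖²⟩ ≥ b²/(256π⁴(n+1)⁴ν²)`, uniformly in `a₀`);
`not_boundedEnergy_family_shearMode`, `not_zerothLaw_shape_shearMode(_rest)` (for `b ≠ 0` the summit's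
shape — bounded mean energy and a dissipation floor along `ν_j → 0` — is FALSE with the force pinned to
`shear n b` and the data pinned anywhere on the laminar line, for every admissible choice of solutions).
An honest witness of the root's `∃ f` inside the Kolmogorov family needs data OFF the laminar line
(the open 3-D laminar-attractor problem).
-/

noncomputable section
-- the mandated namespace `Summit.<Summit>.<Problem>.Theorems` repeats `AnomalousDissipation` (single-problem summit)
set_option linter.dupNamespace false

namespace Summit.AnomalousDissipation.AnomalousDissipation.Theorems.RestMeanFloorTG.Negative

open MeasureTheory Set Filter Topology UnitAddTorus
open scoped ENNReal NNReal InnerProductSpace ContDiff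
open Literature.Analysis.FunctionSpaces Literature.Analysis.FunctionSpaces.Torus
open Literature.Analysis.FluidPDE Literature.Analysis.FluidPDE.Torus
open Summit.AnomalousDissipation.AnomalousDissipation.Theorems.TwohalfdNeg.Negative

/-! ## 1. Mode-`n` amplitude-modulated shears `t ↦ shear n (a t) = (0, 0, a(t) cos 2π(n+1)x₀)` -/

/-- `(0, 0, c · cos 2π(n+1)y₀)` as a `2½`-dimensional field is the laminar state `shear n c`. [folklore] -/
theorem twoHalf_mulProfileMode (n : ℕ) (c : ℝ) :
    twoHalf (0 : UnitAddTorus (Fin 2) → EuclideanSpace ℝ (Fin 2)) (fun y => c * profile n 1 y) = shear n c := by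
  have h : (fun y => c * profile n 1 y) = profile n c := funext fun y => by rw [← profile_mul, mul_one]
  rw [h]
  rfl

/-- The profile `(t, y) ↦ a(t) cos 2π(n+1)y₀` is jointly smooth for smooth `a`. [folklore] -/
theorem isSmoothSpaceTimeOn_mulProfileMode (n : ℕ) (a : ℝ → ℝ) (ha : ContDiff ℝ ∞ a) :
    Literature.Analysis.FunctionSpaces.Torus.IsSmoothSpaceTimeOn univ
      (fun t (y : UnitAddTorus (Fin 2)) => a t * profile n 1 y) := by
  have h1 : Literature.Analysis.FunctionSpaces.Torus.IsSmoothSpaceTimeOn univ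
      (fun t (_ : UnitAddTorus (Fin 2)) => a t) := by
    unfold Literature.Analysis.FunctionSpaces.Torus.IsSmoothSpaceTimeOn
    have : stLift (fun t (_ : UnitAddTorus (Fin 2)) => a t) = a ∘ Prod.fst := by
      funext p
      rfl
    rw [this]
    exact (ha.comp contDiff_fst).contDiffOn
  have h2 : Literature.Analysis.FunctionSpaces.Torus.IsSmoothSpaceTimeOn univ (fun (_ : ℝ) => profile n 1) :=
    isSmoothSpaceTimeOn_const (isSmooth_profile n 1) _
  exact h1.mul h2

/-- `∂ₜ(a(t) cos 2π(n+1)y₀) = a'(t) cos 2π(n+1)y₀`. [folklore] -/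
theorem timeDerivWithin_mulProfileMode (n : ℕ) (a : ℝ → ℝ) (t : ℝ) (y : UnitAddTorus (Fin 2)) :
    Literature.Analysis.FunctionSpaces.Torus.timeDerivWithin univ
      (fun t (y : UnitAddTorus (Fin 2)) => a t * profile n 1 y) t y = deriv a t * profile n 1 y := by
  unfold Literature.Analysis.FunctionSpaces.Torus.timeDerivWithin
  rw [derivWithin_univ]
  exact deriv_mul_const_field _

/-- `Δ(c cos 2π(n+1)y₀) = −4π²(n+1)² c cos 2π(n+1)y₀`. [folklore] -/
theorem laplacian_mulProfileMode (n : ℕ) (c : ℝ) (y : UnitAddTorus (Fin 2)) :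
    Torus.laplacian (fun y : UnitAddTorus (Fin 2) => c * profile n 1 y) y =
      -(4 * Real.pi ^ 2 * ((n : ℝ) + 1) ^ 2) * (c * profile n 1 y) := by
  have h : (fun y : UnitAddTorus (Fin 2) => c * profile n 1 y) = profile n c :=
    funext fun y => by rw [← profile_mul, mul_one]
  have hp : profile n c y = c * profile n 1 y := by rw [← profile_mul, mul_one]
  rw [h, laplacian_profile, hp]

/-- Residual force of the ansatz `(0, 0, a(t) cos 2π(n+1)x₀)` = `shear n (a' + 4π²(n+1)²ν a)`. [folklore] -/
theorem twoHalfForce_mulProfileMode (n : ℕ) (a : ℝ → ℝ) (ν : ℝ) :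
    twoHalfForce univ ν (fun _ => (0 : UnitAddTorus (Fin 2) → EuclideanSpace ℝ (Fin 2)))
      (fun t (y : UnitAddTorus (Fin 2)) => a t * profile n 1 y) (fun _ _ => (0 : ℝ)) =
      fun t => shear n (deriv a t + 4 * Real.pi ^ 2 * ((n : ℝ) + 1) ^ 2 * ν * a t) := by
  funext t x
  rw [twoHalfForce_apply, shear]
  have h1 : (fun y => Literature.Analysis.FunctionSpaces.Torus.timeDerivWithin univ
      (fun _ : ℝ => (0 : UnitAddTorus (Fin 2) → EuclideanSpace ℝ (Fin 2))) t y +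
      Torus.convect ((fun _ : ℝ => (0 : UnitAddTorus (Fin 2) → EuclideanSpace ℝ (Fin 2))) t)
        ((fun _ : ℝ => (0 : UnitAddTorus (Fin 2) → EuclideanSpace ℝ (Fin 2))) t) y -
      ν • Torus.laplacian ((fun _ : ℝ => (0 : UnitAddTorus (Fin 2) → EuclideanSpace ℝ (Fin 2))) t) y +
      Torus.gradient ((fun _ _ => (0 : ℝ)) t) y) = (0 : UnitAddTorus (Fin 2) → EuclideanSpace ℝ (Fin 2)) := by
    funext y
    simp only [timeDerivWithin_const_fun, convect_zero₂, laplacian_zero₂, gradient_zero₂, smul_zero]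
    simp
  have h2 : (fun y => Literature.Analysis.FunctionSpaces.Torus.timeDerivWithin univ
      (fun t (y : UnitAddTorus (Fin 2)) => a t * profile n 1 y) t y +
      ⟪((fun _ : ℝ => (0 : UnitAddTorus (Fin 2) → EuclideanSpace ℝ (Fin 2))) t) y,
        Torus.gradient ((fun t (y : UnitAddTorus (Fin 2)) => a t * profile n 1 y) t) y⟫_ℝ -
      ν * Torus.laplacian ((fun t (y : UnitAddTorus (Fin 2)) => a t * profile n 1 y) t) y) =
      TwohalfdNeg.Negative.profile n (deriv a t + 4 * Real.pi ^ 2 * ((n : ℝ) + 1) ^ 2 * ν * a t) := by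
    funext y
    have hp : TwohalfdNeg.Negative.profile n (deriv a t + 4 * Real.pi ^ 2 * ((n : ℝ) + 1) ^ 2 * ν * a t) y =
        (deriv a t + 4 * Real.pi ^ 2 * ((n : ℝ) + 1) ^ 2 * ν * a t) * profile n 1 y := by
      rw [← profile_mul, mul_one]
    rw [timeDerivWithin_mulProfileMode, hp]
    simp only [laplacian_mulProfileMode, Pi.zero_apply, inner_zero_left]
    ring
  rw [h1, h2]

/-- **Modulated mode-`n` shears are classical NS solutions** (force `shear n (a' + 4π²(n+1)²ν a)`). [folklore] -/
theorem isClassicalNSSolutionOn_ampShearMode (n : ℕ) (a : ℝ → ℝ) (ha : ContDiff ℝ ∞ a) (ν : ℝ) :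
    IsClassicalNSSolutionOn univ ν (fun t => shear n (deriv a t + 4 * Real.pi ^ 2 * ((n : ℝ) + 1) ^ 2 * ν * a t))
      (fun t => shear n (a t)) (fun _ => (fun _ : UnitAddTorus (Fin 2) => (0 : ℝ)) ∘ planarProj) := by
  have hV : Literature.Analysis.FunctionSpaces.Torus.IsSmoothSpaceTimeOn univ
      (fun _ : ℝ => (0 : UnitAddTorus (Fin 2) → EuclideanSpace ℝ (Fin 2))) :=
    isSmoothSpaceTimeOn_const isSmooth_zero₂ _
  have hφ : Literature.Analysis.FunctionSpaces.Torus.IsSmoothSpaceTimeOn univ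
      (fun _ : ℝ => fun _ : UnitAddTorus (Fin 2) => (0 : ℝ)) :=
    isSmoothSpaceTimeOn_const (isSmooth_const (0 : ℝ)) _
  have hcl := isClassicalNSSolutionOn_twoHalf uniqueDiffOn_univ ν hV (isSmoothSpaceTimeOn_mulProfileMode n a ha) hφ
    (fun _ _ x => by simp [Torus.divergence, Torus.partialDeriv, Torus.lineDeriv])
  have hu : (fun t => twoHalf ((fun _ : ℝ => (0 : UnitAddTorus (Fin 2) → EuclideanSpace ℝ (Fin 2))) t)
      ((fun t (y : UnitAddTorus (Fin 2)) => a t * profile n 1 y) t)) = fun t => shear n (a t) :=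
    funext fun t => twoHalf_mulProfileMode n (a t)
  rw [twoHalfForce_mulProfileMode, hu] at hcl
  exact hcl

/-! ## 2. The laminar amplitude `a(t) = A + (a₀ − A)e^{−ct}` (solution of `a' + c a = c A`, `a(0) = a₀`) -/

/-- `a` is smooth. [folklore] -/
theorem contDiff_ampLine (c A a₀ : ℝ) : ContDiff ℝ ∞ (fun s : ℝ => A + (a₀ - A) * Real.exp (-(c * s))) :=
  contDiff_const.add (contDiff_const.mul ((contDiff_const.mul contDiff_id).neg.exp))

/-- `a'(t) = −c (a₀ − A) e^{−ct}`. [folklore] -/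
theorem hasDerivAt_ampLine (c A a₀ t : ℝ) :
    HasDerivAt (fun s : ℝ => A + (a₀ - A) * Real.exp (-(c * s))) (-(c * ((a₀ - A) * Real.exp (-(c * t))))) t := by
  have h1 : HasDerivAt (fun s : ℝ => -(c * s)) (-(c * 1)) t := ((hasDerivAt_id' t).const_mul c).neg
  have h2 : HasDerivAt (fun s : ℝ => A + (a₀ - A) * Real.exp (-(c * s)))
      (0 + (a₀ - A) * (Real.exp (-(c * t)) * -(c * 1))) t :=
    (hasDerivAt_const t A).add (h1.exp.const_mul (a₀ - A))
  exact h2.congr_deriv (by ring)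

/-- The ODE `a' + c a = c A`. [folklore] -/
theorem deriv_ampLine_add (c A a₀ t : ℝ) :
    deriv (fun s : ℝ => A + (a₀ - A) * Real.exp (-(c * s))) t + c * (A + (a₀ - A) * Real.exp (-(c * t))) = c * A := by
  rw [(hasDerivAt_ampLine c A a₀ t).deriv]
  ring

/-- Upper bound `|a(t)| ≤ |A| + |a₀ − A|` for `t ≥ 0` (`c ≥ 0`). [folklore] -/
theorem abs_ampLine_le {c A a₀ t : ℝ} (hc : 0 ≤ c) (ht : 0 ≤ t) :
    |A + (a₀ - A) * Real.exp (-(c * t))| ≤ |A| + |a₀ - A| := by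
  have he : Real.exp (-(c * t)) ≤ 1 := Real.exp_le_one_iff.2 (neg_nonpos.2 (mul_nonneg hc ht))
  have he0 : 0 < Real.exp (-(c * t)) := Real.exp_pos _
  calc |A + (a₀ - A) * Real.exp (-(c * t))| ≤ |A| + |(a₀ - A) * Real.exp (-(c * t))| := abs_add_le _ _
    _ = |A| + |a₀ - A| * Real.exp (-(c * t)) := by rw [abs_mul, abs_of_pos he0]
    _ ≤ |A| + |a₀ - A| * 1 := by gcongr
    _ = |A| + |a₀ - A| := by rw [mul_one]

/-- Eventual lower bound `|a(t)| ≥ |A|/2` once `c|A|t ≥ 2|a₀ − A|` (`e^{−ct} ≤ 1/(1 + ct)`). [folklore] -/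
theorem half_abs_le_abs_ampLine {c A a₀ t : ℝ} (hc : 0 < c) (ht : 0 ≤ t)
    (hT : 2 * |a₀ - A| ≤ |A| * (c * t)) :
    |A| / 2 ≤ |A + (a₀ - A) * Real.exp (-(c * t))| := by
  have he0 : 0 < Real.exp (-(c * t)) := Real.exp_pos _
  have hct : 0 < 1 + c * t := by positivity
  have he : Real.exp (-(c * t)) ≤ 1 / (1 + c * t) := by
    rw [Real.exp_neg, one_div]
    exact inv_anti₀ hct (by linarith [Real.add_one_le_exp (c * t)])
  have hD : |a₀ - A| * Real.exp (-(c * t)) ≤ |A| / 2 := by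
    calc |a₀ - A| * Real.exp (-(c * t)) ≤ |a₀ - A| * (1 / (1 + c * t)) :=
          mul_le_mul_of_nonneg_left he (abs_nonneg _)
      _ = |a₀ - A| / (1 + c * t) := by rw [mul_one_div]
      _ ≤ |A| / 2 := by
          rw [div_le_div_iff₀ hct two_pos]
          nlinarith [abs_nonneg A, abs_nonneg (a₀ - A), hT]
  have h1 : |A| - |(a₀ - A) * Real.exp (-(c * t))| ≤ |A + (a₀ - A) * Real.exp (-(c * t))| := by
    have := abs_sub_abs_le_abs_sub A (-((a₀ - A) * Real.exp (-(c * t))))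
    rwa [abs_neg, sub_neg_eq_add] at this
  rw [abs_mul, abs_of_pos he0] at h1
  linarith

/-- The engine on the laminar line: `⟨M a(t)²⟩ ≥ M A²/8` (`|a| ≥ |A|/2` eventually, Cesàro floor). [folklore] -/
theorem longTimeAvgSup_ampLine_sq_ge {c A a₀ M : ℝ} (hc : 0 < c) (hM : 0 ≤ M) :
    M * A ^ 2 / 8 ≤ longTimeAvgSup (fun t => M * (A + (a₀ - A) * Real.exp (-(c * t))) ^ 2) := by
  have hcont : Continuous (fun t => M * (A + (a₀ - A) * Real.exp (-(c * t))) ^ 2) := by fun_prop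
  have h0 : ∀ t, 0 ≤ M * (A + (a₀ - A) * Real.exp (-(c * t))) ^ 2 := fun t => mul_nonneg hM (sq_nonneg _)
  have hB : ∀ t, 0 < t → M * (A + (a₀ - A) * Real.exp (-(c * t))) ^ 2 ≤ M * (|A| + |a₀ - A|) ^ 2 := fun t ht => by
    refine mul_le_mul_of_nonneg_left ?_ hM
    rw [← sq_abs (A + (a₀ - A) * Real.exp (-(c * t)))]
    exact pow_le_pow_left₀ (abs_nonneg _) (abs_ampLine_le hc.le ht.le) 2
  obtain ⟨t₀, ht₀, hK⟩ : ∃ t₀ : ℝ, 0 ≤ t₀ ∧ ∀ t, t₀ ≤ t →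
      M * A ^ 2 / 4 ≤ M * (A + (a₀ - A) * Real.exp (-(c * t))) ^ 2 := by
    rcases eq_or_ne A 0 with hA | hA
    · refine ⟨0, le_rfl, fun t _ => ?_⟩
      subst hA
      simpa using h0 t
    · have hA' : 0 < |A| := abs_pos.2 hA
      refine ⟨2 * |a₀ - A| / (|A| * c), by positivity, fun t ht => ?_⟩
      have ht0 : 0 ≤ t := le_trans (by positivity) ht
      have hT : 2 * |a₀ - A| ≤ |A| * (c * t) := by
        rw [div_le_iff₀ (by positivity)] at ht
        linarith
      have h' : (|A| / 2) ^ 2 ≤ (A + (a₀ - A) * Real.exp (-(c * t))) ^ 2 := by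
        rw [← sq_abs (A + (a₀ - A) * Real.exp (-(c * t)))]
        exact pow_le_pow_left₀ (by positivity) (half_abs_le_abs_ampLine hc ht0 hT) 2
      calc M * A ^ 2 / 4 = M * (|A| / 2) ^ 2 := by rw [div_pow, sq_abs]; ring
        _ ≤ M * (A + (a₀ - A) * Real.exp (-(c * t))) ^ 2 := mul_le_mul_of_nonneg_left h' hM
  have h := half_le_longTimeAvgSup hcont h0 hB ht₀ (by positivity) hK
  linarith

/-- Mean energy of the laminar flow: `⟨‖shear n a(t)‖²⟩ ≥ A²/16`. [folklore] -/
theorem meanEnergy_laminarLine_ge (n : ℕ) {c A : ℝ} (a₀ : ℝ) (hc : 0 < c) :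
    A ^ 2 / 16 ≤ meanEnergy (fun t => shear n (A + (a₀ - A) * Real.exp (-(c * t)))) := by
  rw [meanEnergy_eq_longTimeAvgSup]
  have h : (fun t => ∫ x, ‖shear n (A + (a₀ - A) * Real.exp (-(c * t))) x‖ ^ 2) =
      fun t => (1 / 2) * (A + (a₀ - A) * Real.exp (-(c * t))) ^ 2 := by
    funext t
    rw [integral_norm_sq_shear]
    ring
  rw [h]
  have := longTimeAvgSup_ampLine_sq_ge (a₀ := a₀) (A := A) hc (by norm_num : (0 : ℝ) ≤ 1 / 2)
  linarith

/-- Mean dissipation of the laminar flow: `⟨ν‖∇ shear n a(t)‖²⟩ ≥ ν π²(n+1)² A²/4` (`ν ≥ 0`). [folklore] -/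
theorem meanDissipation_laminarLine_ge (n : ℕ) {ν c A : ℝ} (a₀ : ℝ) (hν : 0 ≤ ν) (hc : 0 < c) :
    ν * (2 * Real.pi ^ 2 * ((n : ℝ) + 1) ^ 2) * A ^ 2 / 8 ≤
      meanDissipation ν (fun t => shear n (A + (a₀ - A) * Real.exp (-(c * t)))) := by
  unfold meanDissipation
  have h : (fun t => ν * (eGradNormSq (shear n (A + (a₀ - A) * Real.exp (-(c * t))))).toReal) =
      fun t => ν * (2 * Real.pi ^ 2 * ((n : ℝ) + 1) ^ 2) * (A + (a₀ - A) * Real.exp (-(c * t))) ^ 2 := by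
    funext t
    rw [toReal_eGradNormSq_shear]
    ring
  rw [h]
  exact longTimeAvgSup_ampLine_sq_ge hc (by positivity)

/-! ## 3. Uniqueness on the laminar line of the mode-`n` shear force -/

/-- **Uniqueness on the laminar line.** For `ν > 0`, EVERY global Leray–Hopf solution with force
`shear n b` and datum `shear n a₀` is the laminar flow `shear n (A + (a₀ − A)e^{−ct})`, `c = 4π²(n+1)²ν`,
`A = b/c`, a.e. at every `t > 0` (`Torus.IsGlobalLerayHopf.ae_eq_of_isClassicalNSSolutionOn_univ_forced`). [folklore] -/
theorem ae_eq_laminar_of_isGlobalLerayHopf_shearMode (n : ℕ) {ν : ℝ} (hν : 0 < ν) {a₀ b : ℝ}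
    {u : ℝ → UnitAddTorus (Fin 3) → EuclideanSpace ℝ (Fin 3)}
    (hu : IsGlobalLerayHopf ν (fun _ => shear n b) (shear n a₀) u) :
    ∀ t : ℝ, 0 < t → u t =ᵐ[volume]
      shear n (b / (4 * Real.pi ^ 2 * ((n : ℝ) + 1) ^ 2 * ν) +
        (a₀ - b / (4 * Real.pi ^ 2 * ((n : ℝ) + 1) ^ 2 * ν)) *
          Real.exp (-(4 * Real.pi ^ 2 * ((n : ℝ) + 1) ^ 2 * ν * t))) := by
  have hc : 0 < 4 * Real.pi ^ 2 * ((n : ℝ) + 1) ^ 2 * ν := by positivity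
  set c : ℝ := 4 * Real.pi ^ 2 * ((n : ℝ) + 1) ^ 2 * ν with hc_def
  set A : ℝ := b / c with hA_def
  set a : ℝ → ℝ := fun s => A + (a₀ - A) * Real.exp (-(c * s)) with ha_def
  have hcl := isClassicalNSSolutionOn_ampShearMode n a (contDiff_ampLine c A a₀) ν
  have hb : ∀ t, deriv a t + 4 * Real.pi ^ 2 * ((n : ℝ) + 1) ^ 2 * ν * a t = b := fun t => by
    rw [← hc_def, ha_def, deriv_ampLine_add, hA_def, mul_div_cancel₀ _ hc.ne']
  have hf : (fun t => shear n (deriv a t + 4 * Real.pi ^ 2 * ((n : ℝ) + 1) ^ 2 * ν * a t)) =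
      fun _ => (shear n b : UnitAddTorus (Fin 3) → EuclideanSpace ℝ (Fin 3)) := funext fun t => by rw [hb t]
  rw [hf] at hcl
  have h0 : (fun t => shear n (a t)) 0 = shear n a₀ := by
    show shear n (a 0) = shear n a₀
    rw [ha_def]
    simp
  have hu' : IsGlobalLerayHopf ν (fun _ => shear n b) ((fun t => shear n (a t)) 0) u := by
    rw [h0]
    exact hu
  intro t ht
  exact hu'.ae_eq_of_isClassicalNSSolutionOn_univ_forced hcl hν.le t ht

/-! ## 4. The long-time means of any solution on the laminar line -/

/-- The spectral `‖∇·‖₂²` only sees the a.e.-class (Fourier coefficients are integrals). [folklore] -/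
private theorem eGradNormSq_congr_ae'' {v w : UnitAddTorus (Fin 3) → EuclideanSpace ℝ (Fin 3)}
    (h : v =ᵐ[volume] w) : eGradNormSq v = eGradNormSq w := by
  have h' : (EuclideanSpace.complexify ∘ v) =ᵐ[volume] (EuclideanSpace.complexify ∘ w) :=
    h.fun_comp EuclideanSpace.complexify
  unfold eGradNormSq eHomSobolevSeminorm
  simp_rw [mFourierCoeff_congr_ae h']

/-- **Mean energy of any Leray–Hopf solution on the laminar line = that of the laminar flow.** [folklore] -/
theorem meanEnergy_eq_laminar_of_isGlobalLerayHopf_shearMode (n : ℕ) {ν : ℝ} (hν : 0 < ν) {a₀ b : ℝ}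
    {u : ℝ → UnitAddTorus (Fin 3) → EuclideanSpace ℝ (Fin 3)}
    (hu : IsGlobalLerayHopf ν (fun _ => shear n b) (shear n a₀) u) :
    meanEnergy u = meanEnergy (fun t =>
      shear n (b / (4 * Real.pi ^ 2 * ((n : ℝ) + 1) ^ 2 * ν) +
        (a₀ - b / (4 * Real.pi ^ 2 * ((n : ℝ) + 1) ^ 2 * ν)) *
          Real.exp (-(4 * Real.pi ^ 2 * ((n : ℝ) + 1) ^ 2 * ν * t)))) := by
  rw [meanEnergy_eq_longTimeAvgSup, meanEnergy_eq_longTimeAvgSup]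
  refine longTimeAvgSup_congr_of_eqOn_Ioi fun t ht => integral_congr_ae ?_
  filter_upwards [ae_eq_laminar_of_isGlobalLerayHopf_shearMode n hν hu t ht] with x hx
  rw [hx]

/-- **Mean dissipation of any Leray–Hopf solution on the laminar line = that of the laminar flow.** [folklore] -/
theorem meanDissipation_eq_laminar_of_isGlobalLerayHopf_shearMode (n : ℕ) {ν : ℝ} (hν : 0 < ν) {a₀ b : ℝ}
    {u : ℝ → UnitAddTorus (Fin 3) → EuclideanSpace ℝ (Fin 3)}
    (hu : IsGlobalLerayHopf ν (fun _ => shear n b) (shear n a₀) u) :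
    meanDissipation ν u = meanDissipation ν (fun t =>
      shear n (b / (4 * Real.pi ^ 2 * ((n : ℝ) + 1) ^ 2 * ν) +
        (a₀ - b / (4 * Real.pi ^ 2 * ((n : ℝ) + 1) ^ 2 * ν)) *
          Real.exp (-(4 * Real.pi ^ 2 * ((n : ℝ) + 1) ^ 2 * ν * t)))) := by
  unfold meanDissipation
  refine longTimeAvgSup_congr_of_eqOn_Ioi fun t ht => ?_
  rw [eGradNormSq_congr_ae'' (ae_eq_laminar_of_isGlobalLerayHopf_shearMode n hν hu t ht)]

/-- **Energy of EVERY Leray–Hopf solution on the laminar line**: `⟨‖u‖²⟩ ≥ b²/(256π⁴(n+1)⁴ν²)`. [folklore] -/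
theorem le_meanEnergy_of_isGlobalLerayHopf_shearMode (n : ℕ) {ν : ℝ} (hν : 0 < ν) {a₀ b : ℝ}
    {u : ℝ → UnitAddTorus (Fin 3) → EuclideanSpace ℝ (Fin 3)}
    (hu : IsGlobalLerayHopf ν (fun _ => shear n b) (shear n a₀) u) :
    b ^ 2 / (256 * Real.pi ^ 4 * ((n : ℝ) + 1) ^ 4 * ν ^ 2) ≤ meanEnergy u := by
  rw [meanEnergy_eq_laminar_of_isGlobalLerayHopf_shearMode n hν hu]
  have hc : 0 < 4 * Real.pi ^ 2 * ((n : ℝ) + 1) ^ 2 * ν := by positivity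
  refine le_trans (le_of_eq ?_) (meanEnergy_laminarLine_ge n a₀ hc)
  have hν0 : ν ≠ 0 := hν.ne'
  have hπ : Real.pi ≠ 0 := Real.pi_ne_zero
  have hn : ((n : ℝ) + 1) ≠ 0 := by positivity
  field_simp
  ring

/-- **Dissipation of EVERY Leray–Hopf solution on the laminar line**: `⟨ν‖∇u‖²⟩ ≥ b²/(64π²(n+1)²ν)`. [folklore] -/
theorem le_meanDissipation_of_isGlobalLerayHopf_shearMode (n : ℕ) {ν : ℝ} (hν : 0 < ν) {a₀ b : ℝ}
    {u : ℝ → UnitAddTorus (Fin 3) → EuclideanSpace ℝ (Fin 3)}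
    (hu : IsGlobalLerayHopf ν (fun _ => shear n b) (shear n a₀) u) :
    b ^ 2 / (64 * Real.pi ^ 2 * ((n : ℝ) + 1) ^ 2 * ν) ≤ meanDissipation ν u := by
  rw [meanDissipation_eq_laminar_of_isGlobalLerayHopf_shearMode n hν hu]
  have hc : 0 < 4 * Real.pi ^ 2 * ((n : ℝ) + 1) ^ 2 * ν := by positivity
  refine le_trans (le_of_eq ?_) (meanDissipation_laminarLine_ge n a₀ hν.le hc)
  have hν0 : ν ≠ 0 := hν.ne'
  have hπ : Real.pi ≠ 0 := Real.pi_ne_zero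
  have hn : ((n : ℝ) + 1) ≠ 0 := by positivity
  field_simp
  ring

/-! ## 5. Consequences: no bounded-energy vanishing-viscosity family on any laminar line -/

/-- **No vanishing-viscosity family on the laminar line of a Kolmogorov shear force has bounded mean
energy** (`b ≠ 0`; data `shear n (α j)`; ANY solutions `u_j`: `⟨‖u_j‖²⟩ ≥ b²/(256π⁴(n+1)⁴ν_j²) → ∞`). [folklore] -/
theorem not_boundedEnergy_family_shearMode (n : ℕ) {b : ℝ} (hb : b ≠ 0) :
    ¬ ∃ (ν : ℕ → ℝ) (α : ℕ → ℝ) (u : ℕ → ℝ → UnitAddTorus (Fin 3) → EuclideanSpace ℝ (Fin 3)),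
        (∀ j, 0 < ν j) ∧ Tendsto ν atTop (𝓝 0) ∧
        (∀ j, IsGlobalLerayHopf (ν j) (fun _ => shear n b) (shear n (α j)) (u j)) ∧
        ∃ E : ℝ, ∀ j, meanEnergy (u j) ≤ E := by
  rintro ⟨ν, α, u, hν, hν0, hu, E, hE⟩
  -- the constant `κ = b²/(256π⁴(n+1)⁴) > 0` and a viscosity `ν j` with `ν_j < 1`, `ν_j (|E|+1) < κ`
  set κ : ℝ := b ^ 2 / (256 * Real.pi ^ 4 * ((n : ℝ) + 1) ^ 4) with hκ
  have hκ0 : 0 < κ := by positivity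
  have hE1 : 0 < |E| + 1 := by positivity
  set δ : ℝ := min 1 (κ / (|E| + 1)) with hδ
  have hδ0 : 0 < δ := lt_min one_pos (by positivity)
  have hev : ∀ᶠ j in atTop, ν j < δ := (tendsto_order.1 hν0).2 δ hδ0
  obtain ⟨j, hj⟩ := hev.exists
  have hνj := hν j
  have hνj1 : ν j < 1 := hj.trans_le (min_le_left _ _)
  have hνjδ : ν j < κ / (|E| + 1) := hj.trans_le (min_le_right _ _)
  have hlow := le_meanEnergy_of_isGlobalLerayHopf_shearMode n hνj (hu j)
  have hEj := hE j
  have hrew : b ^ 2 / (256 * Real.pi ^ 4 * ((n : ℝ) + 1) ^ 4 * ν j ^ 2) = κ / ν j ^ 2 := by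
    rw [hκ, div_div]
  rw [hrew] at hlow
  have h1 : |E| + 1 < κ / ν j := by
    rw [lt_div_iff₀ hνj]
    rw [lt_div_iff₀ hE1] at hνjδ
    linarith
  have h2 : κ / ν j ≤ κ / ν j ^ 2 := by
    refine div_le_div_of_nonneg_left hκ0.le (by positivity) ?_
    nlinarith
  have h3 : E ≤ |E| := le_abs_self E
  linarith

/-- **The summit's shape is FALSE on every laminar line of every Kolmogorov shear force** (`b ≠ 0`,
data `shear n (α j)`, any admissible `u_j`): already the energy clause fails
(`not_boundedEnergy_family_shearMode`). [folklore] -/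
theorem not_zerothLaw_shape_shearMode (n : ℕ) {b : ℝ} (hb : b ≠ 0) :
    ¬ ∃ (ν : ℕ → ℝ) (α : ℕ → ℝ) (u : ℕ → ℝ → UnitAddTorus (Fin 3) → EuclideanSpace ℝ (Fin 3)),
        (∀ j, 0 < ν j) ∧ Tendsto ν atTop (𝓝 0) ∧
        (∀ j, IsGlobalLerayHopf (ν j) (fun _ => shear n b) (shear n (α j)) (u j)) ∧
        (∃ E : ℝ, ∀ j, meanEnergy (u j) ≤ E) ∧
        ∃ ε : ℝ, 0 < ε ∧ ∀ j, ε ≤ meanDissipation (ν j) (u j) := by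
  rintro ⟨ν, α, u, hν, hν0, hu, hE, -⟩
  exact not_boundedEnergy_family_shearMode n hb ⟨ν, α, u, hν, hν0, hu, hE⟩

/-- **Rest specialisation** (`α ≡ 0`, `shear n 0 = 0`): the mode-`n`, amplitude-`b` generalisation of
`not_zerothLaw_shape_shear_rest`. [folklore] -/
theorem not_zerothLaw_shape_shearMode_rest (n : ℕ) {b : ℝ} (hb : b ≠ 0) :
    ¬ ∃ (ν : ℕ → ℝ) (u : ℕ → ℝ → UnitAddTorus (Fin 3) → EuclideanSpace ℝ (Fin 3)),
        (∀ j, 0 < ν j) ∧ Tendsto ν atTop (𝓝 0) ∧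
        (∀ j, IsGlobalLerayHopf (ν j) (fun _ => shear n b) 0 (u j)) ∧
        (∃ E : ℝ, ∀ j, meanEnergy (u j) ≤ E) ∧
        ∃ ε : ℝ, 0 < ε ∧ ∀ j, ε ≤ meanDissipation (ν j) (u j) := by
  have h0 : (shear n 0 : UnitAddTorus (Fin 3) → EuclideanSpace ℝ (Fin 3)) = 0 := by
    funext x
    have h := norm_shear_le n 0 x
    rw [abs_zero] at h
    rw [Pi.zero_apply]
    exact norm_le_zero_iff.1 h
  rintro ⟨ν, u, hν, hν0, hu, hE, hε⟩
  refine not_zerothLaw_shape_shearMode n hb ⟨ν, fun _ => 0, u, hν, hν0, fun j => ?_, hE, hε⟩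
  rw [h0]
  exact hu j

end Summit.AnomalousDissipation.AnomalousDissipation.Theorems.RestMeanFloorTG.Negative

end
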